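import Summits.KontsevichZagierPeriods.KontsevichZagierPeriods.Theses.IsogenyCertificates

/-!
# `XMapPeriodTransfer`: the value side, I — value formula, positivity, the diagonal case, signs

Negative knowledge for the crux `IsogenyCertificates.XMapPeriodTransfer`
(stmt-KontsevichZagierPeriods-10665; refuter, cdisprove). No new definitions.

* `value_eq`, `integrableOn_of_rep`, `period_pos`, `value_pos`: for any representation with the
  crux's data, `r.value = a · ∫_{P>0} dx/√P`, the integrand being integrable BECAUSE `r` is, and the
  integral is `> 0` (positive integrand on an open non-empty set) — `r.value` has the sign of `a`;
* `transfer_diagonal`: the DIAGONAL case `(A′,B′) = (A,B)` of the crux is a theorem (value equality and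
  `Ω > 0` pin `a = b`; one integrand-additivity move) — the last step of the planner's chain, certified;
* `iff_anySign`: the hypotheses `0 < a`, `0 < b` are REMOVABLE (mixed signs / one zero are vacuous by
  `value_pos`, `a = b = 0` gives two relations, `a, b < 0` by negating both representations).
Part II (`ValueEqLoadBearing.lean`): non-vacuity and `false_without_valueEq`.
Companion work file: `Cruxes/XMapPeriodTransfer/Disproof.lean`.
-/

noncomputable section

namespace Summit.KontsevichZagierPeriods.IsogenyCertificates.XMapPeriodTransferValue

open Polynomial Set MeasureTheory
open Literature.NumberTheory.Transcendental
open Summit.KontsevichZagierPeriods.KontsevichZagierPeriods.Theses.IsogenyCertificates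

/-! ### KZ helpers (one integrand-additivity move each) -/

/-- Same domain, integrands agreeing on it ⇒ KZ-equivalent: `[r] − [r'] − [z] ∈ rel` for the zero
representation `z` on the common domain, and `[z] ∈ rel`. [cite: KontsevichZagier2001, §1.2 rule (1)] -/
theorem equivalent_of_eqOn {n : ℕ} (r r' : KZ.IntegralRep n) (hd : r'.domain = r.domain)
    (he : EqOn r.integrand r'.integrand r.domain) : KZ.Equivalent r r' := by
  let z : KZ.IntegralRep n :=
    { domain := r.domain, integrand := 0, isSemialgebraic_domain := r.isSemialgebraic_domain,
      isSemialgebraicFunOn_integrand :=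
        (isSemialgebraicFunOn_aeval r.isSemialgebraic_domain (0 : MvPolynomial (Fin n) ℚ)).congr
          fun x _ => by simp,
      integrableOn := integrableOn_zero }
  have h1 : KZ.of r - KZ.of r' - KZ.of z ∈ KZ.relations :=
    KZ.integrandAddRel_subset_relations ⟨n, r, r', z, hd, rfl, fun x hx => by simp [z, he hx], rfl⟩
  have h2 : KZ.of z ∈ KZ.relations := by
    have h : KZ.of z - KZ.of z - KZ.of z ∈ KZ.relations :=
      KZ.integrandAddRel_subset_relations ⟨n, z, z, z, rfl, rfl, fun x _ => by simp [z], rfl⟩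
    rw [sub_self, zero_sub] at h
    simpa using KZ.relations.neg_mem h
  have := KZ.relations.add_mem h1 h2
  rwa [sub_add_cancel] at this

/-- `[r] + [r.neg] ∈ relations`. [cite: KontsevichZagier2001, §1.2 rule (1)] -/
theorem of_add_of_neg_mem_relations {n : ℕ} (r : KZ.IntegralRep n) :
    KZ.of r + KZ.of r.neg ∈ KZ.relations := by
  let z : KZ.IntegralRep n :=
    { domain := r.domain, integrand := 0, isSemialgebraic_domain := r.isSemialgebraic_domain,
      isSemialgebraicFunOn_integrand :=
        (isSemialgebraicFunOn_aeval r.isSemialgebraic_domain (0 : MvPolynomial (Fin n) ℚ)).congr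
          fun x _ => by simp,
      integrableOn := integrableOn_zero }
  have h1 : KZ.of z - KZ.of r - KZ.of r.neg ∈ KZ.relations :=
    KZ.integrandAddRel_subset_relations ⟨n, z, r, r.neg, rfl, rfl, fun x _ => by simp [z], rfl⟩
  have h2 : KZ.of z ∈ KZ.relations := by
    have h : KZ.of z - KZ.of z - KZ.of z ∈ KZ.relations :=
      KZ.integrandAddRel_subset_relations ⟨n, z, z, z, rfl, rfl, fun x _ => by simp [z], rfl⟩
    rw [sub_self, zero_sub] at h
    simpa using KZ.relations.neg_mem h
  have := KZ.relations.sub_mem h2 h1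
  rwa [show KZ.of z - (KZ.of z - KZ.of r - KZ.of r.neg) = KZ.of r + KZ.of r.neg by abel] at this

/-- Equivalence of the negatives ⇒ equivalence. [cite: KontsevichZagier2001, §1.2 rule (1)] -/
theorem equivalent_of_equivalent_neg {n m : ℕ} (r : KZ.IntegralRep n) (r' : KZ.IntegralRep m)
    (h : KZ.Equivalent r.neg r'.neg) : KZ.Equivalent r r' := by
  have h1 := of_add_of_neg_mem_relations r
  have h2 := of_add_of_neg_mem_relations r'
  have := KZ.relations.sub_mem (KZ.relations.sub_mem h1 h2) h
  unfold KZ.Equivalent at h ⊢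
  rwa [show KZ.of r + KZ.of r.neg - (KZ.of r' + KZ.of r'.neg) - (KZ.of r.neg - KZ.of r'.neg) =
    KZ.of r - KZ.of r' by abel] at this

/-! ### The value of a real-period representation and its sign -/

section Value

variable {A B : ℤ} {a : ℚ}

/-- `{P > 0}` is non-empty: `P(1 + |A| + |B|) > 0`. [folklore] -/
theorem cubic_pos_large (A B : ℤ) :
    0 < (1 + |(A : ℝ)| + |(B : ℝ)|) ^ 3 + (A : ℝ) * (1 + |(A : ℝ)| + |(B : ℝ)|) + (B : ℝ) := by
  set t : ℝ := 1 + |(A : ℝ)| + |(B : ℝ)| with ht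
  have hA : -|(A : ℝ)| ≤ (A : ℝ) := neg_abs_le _
  have hB : -|(B : ℝ)| ≤ (B : ℝ) := neg_abs_le _
  have h0A : 0 ≤ |(A : ℝ)| := abs_nonneg _
  have h0B : 0 ≤ |(B : ℝ)| := abs_nonneg _
  have ht1 : 1 ≤ t := by rw [ht]; linarith
  nlinarith [mul_le_mul_of_nonneg_left hA (by linarith : (0:ℝ) ≤ t), sq_nonneg t,
    mul_le_mul_of_nonneg_left ht1 (by linarith : (0:ℝ) ≤ t)]

/-- `{P > 0} ⊆ ℝ¹` has positive volume (open, non-empty). [folklore] -/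
theorem volume_setOf_cubic_pos_pos (A B : ℤ) :
    0 < volume {x : Fin 1 → ℝ | 0 < x 0 ^ 3 + (A : ℝ) * x 0 + (B : ℝ)} := by
  have hopen : IsOpen {x : Fin 1 → ℝ | 0 < x 0 ^ 3 + (A : ℝ) * x 0 + (B : ℝ)} :=
    isOpen_lt continuous_const (by fun_prop)
  exact hopen.measure_pos volume ⟨fun _ => 1 + |(A : ℝ)| + |(B : ℝ)|, cubic_pos_large A B⟩

/-- **Value formula**: `r.value = a · ∫_{P>0} dx/√P`. [cite: KontsevichZagier2001, §1.1] -/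
theorem value_eq (r : KZ.IntegralRep 1) (hd : r.domain = {x : Fin 1 → ℝ | 0 < x 0 ^ 3 + (A : ℝ) * x 0 + (B : ℝ)})
    (he : EqOn r.integrand (fun x => (a : ℝ) / Real.sqrt (x 0 ^ 3 + (A : ℝ) * x 0 + (B : ℝ))) r.domain) :
    r.value = (a : ℝ) * ∫ x in {x : Fin 1 → ℝ | 0 < x 0 ^ 3 + (A : ℝ) * x 0 + (B : ℝ)}, 1 / Real.sqrt (x 0 ^ 3 + (A : ℝ) * x 0 + (B : ℝ)) := by
  rw [KZ.IntegralRep.value, setIntegral_congr_fun (KZ.IntegralRep.measurableSet_domain_holds r) he, hd,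
    ← integral_const_mul]
  congr 1; ext x; ring

/-- Integrability of `dx/√P` on `{P>0}` is INHERITED from any representation with `a ≠ 0`. [folklore] -/
theorem integrableOn_of_rep (r : KZ.IntegralRep 1) (hd : r.domain = {x : Fin 1 → ℝ | 0 < x 0 ^ 3 + (A : ℝ) * x 0 + (B : ℝ)})
    (he : EqOn r.integrand (fun x => (a : ℝ) / Real.sqrt (x 0 ^ 3 + (A : ℝ) * x 0 + (B : ℝ))) r.domain) (ha : a ≠ 0) :
    IntegrableOn (fun x : Fin 1 → ℝ => 1 / Real.sqrt (x 0 ^ 3 + (A : ℝ) * x 0 + (B : ℝ))) {x : Fin 1 → ℝ | 0 < x 0 ^ 3 + (A : ℝ) * x 0 + (B : ℝ)} := by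
  have h1 : IntegrableOn (fun x : Fin 1 → ℝ => (a : ℝ) / Real.sqrt (x 0 ^ 3 + (A : ℝ) * x 0 + (B : ℝ))) {x : Fin 1 → ℝ | 0 < x 0 ^ 3 + (A : ℝ) * x 0 + (B : ℝ)} := by
    rw [← hd]; exact r.integrableOn.congr_fun he (KZ.IntegralRep.measurableSet_domain_holds r)
  have h2 : IntegrableOn (fun x : Fin 1 → ℝ => (a : ℝ)⁻¹ * ((a : ℝ) / Real.sqrt (x 0 ^ 3 + (A : ℝ) * x 0 + (B : ℝ)))) {x : Fin 1 → ℝ | 0 < x 0 ^ 3 + (A : ℝ) * x 0 + (B : ℝ)} :=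
    h1.const_mul ((a : ℝ)⁻¹)
  refine IntegrableOn.congr_fun h2 (fun x _ => ?_) (hd ▸ KZ.IntegralRep.measurableSet_domain_holds r)
  have : (a : ℝ) ≠ 0 := by exact_mod_cast ha
  field_simp

/-- **Positivity of the real period**: if `dx/√P` is integrable on `{P>0}`, its integral is `> 0`.
[folklore] -/
theorem period_pos (hint : IntegrableOn (fun x : Fin 1 → ℝ => 1 / Real.sqrt (x 0 ^ 3 + (A : ℝ) * x 0 + (B : ℝ))) {x : Fin 1 → ℝ | 0 < x 0 ^ 3 + (A : ℝ) * x 0 + (B : ℝ)}) :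
    0 < ∫ x in {x : Fin 1 → ℝ | 0 < x 0 ^ 3 + (A : ℝ) * x 0 + (B : ℝ)}, 1 / Real.sqrt (x 0 ^ 3 + (A : ℝ) * x 0 + (B : ℝ)) := by
  have hmeas : MeasurableSet {x : Fin 1 → ℝ | 0 < x 0 ^ 3 + (A : ℝ) * x 0 + (B : ℝ)} :=
    measurableSet_lt measurable_const (by fun_prop)
  rw [setIntegral_pos_iff_support_of_nonneg_ae ?_ hint]
  · have hsub : {x : Fin 1 → ℝ | 0 < x 0 ^ 3 + (A : ℝ) * x 0 + (B : ℝ)} ⊆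
        Function.support (fun x : Fin 1 → ℝ => 1 / Real.sqrt (x 0 ^ 3 + (A : ℝ) * x 0 + (B : ℝ))) ∩ {x : Fin 1 → ℝ | 0 < x 0 ^ 3 + (A : ℝ) * x 0 + (B : ℝ)} := by
      intro x hx
      refine ⟨?_, hx⟩
      simp only [Function.mem_support, ne_eq, one_div, inv_eq_zero]
      exact (Real.sqrt_pos.mpr hx).ne'
    exact (volume_setOf_cubic_pos_pos A B).trans_le (measure_mono hsub)
  · filter_upwards [ae_restrict_mem hmeas] with x hx
    exact div_nonneg zero_le_one (Real.sqrt_nonneg _)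

/-- Hence `r.value` has the sign of `a`. [folklore] -/
theorem value_pos (r : KZ.IntegralRep 1) (hd : r.domain = {x : Fin 1 → ℝ | 0 < x 0 ^ 3 + (A : ℝ) * x 0 + (B : ℝ)})
    (he : EqOn r.integrand (fun x => (a : ℝ) / Real.sqrt (x 0 ^ 3 + (A : ℝ) * x 0 + (B : ℝ))) r.domain) (ha : 0 < a) :
    0 < r.value := by
  rw [value_eq r hd he]
  exact mul_pos (by exact_mod_cast ha) (period_pos (integrableOn_of_rep r hd he ha.ne'))

/-- Negating the scalar negates the representation's data. [folklore] -/
theorem eqOn_neg_integrand (r : KZ.IntegralRep 1)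
    (he : EqOn r.integrand (fun x => (a : ℝ) / Real.sqrt (x 0 ^ 3 + (A : ℝ) * x 0 + (B : ℝ))) r.domain) :
    EqOn r.neg.integrand (fun x => ((-a : ℚ) : ℝ) / Real.sqrt (x 0 ^ 3 + (A : ℝ) * x 0 + (B : ℝ))) r.neg.domain := by
  intro x hx
  simp only [KZ.IntegralRep.integrand_neg, Pi.neg_apply, Rat.cast_neg, neg_div]
  rw [he hx]

end Value

/-! ### The diagonal case is a theorem -/

/-- **`(A′, B′) = (A, B)`: the crux holds** (for ANY datum, e.g. the identity `(X,1,1)` or `[−1]`):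
equal values `aΩ = bΩ` with `Ω > 0` force `a = b`, so the integrands agree on the common domain and
ONE integrand-additivity move joins `r` to `r′`. This is the last step of the route's proof plan.
[cite: KontsevichZagier2001, §1.2 rule (1)] -/
theorem transfer_diagonal (A B : ℤ) : ∀ (a b : ℚ), 0 < a → 0 < b → ∀ (r r' : KZ.IntegralRep 1),
    r.domain = {x | 0 < x 0 ^ 3 + (A : ℝ) * x 0 + (B : ℝ)} →
    EqOn r.integrand (fun x => (a : ℝ) / Real.sqrt (x 0 ^ 3 + (A : ℝ) * x 0 + (B : ℝ))) r.domain →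
    r'.domain = {x | 0 < x 0 ^ 3 + (A : ℝ) * x 0 + (B : ℝ)} →
    EqOn r'.integrand (fun x => (b : ℝ) / Real.sqrt (x 0 ^ 3 + (A : ℝ) * x 0 + (B : ℝ))) r'.domain →
    r.value = r'.value → KZ.Equivalent r r' := by
  intro a b ha _ r r' h1 h2 h3 h4 h5
  have hI := period_pos (integrableOn_of_rep r h1 h2 ha.ne')
  rw [value_eq r h1 h2, value_eq r' h3 h4] at h5
  have hab : (a : ℝ) = b := mul_right_cancel₀ hI.ne' h5
  refine equivalent_of_eqOn r r' (h3.trans h1.symm) fun x hx => ?_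
  rw [h2 hx, h4 (h3.symm ▸ h1 ▸ hx : x ∈ r'.domain), hab]

/-! ### The sign hypotheses `0 < a`, `0 < b` are removable -/

/-- **`0 < a`, `0 < b` are cosmetic**: the crux is EQUIVALENT to its sign-free form. Mixed signs and
exactly one zero scalar are vacuous (`value_pos`: the value has the sign of the scalar), `a = b = 0`
gives two relations (zero integrands), and `a, b < 0` follows from the positive case
applied to the negated representations (`equivalent_of_equivalent_neg`). [folklore] -/
theorem iff_anySign :
    XMapPeriodTransfer ↔ ∀ (A B A' B' : ℤ), 4 * A ^ 3 + 27 * B ^ 2 ≠ 0 → 4 * A' ^ 3 + 27 * B' ^ 2 ≠ 0 →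
    ∀ (f g : ℚ[X]) (c : ℚ), derivative f * g - f * derivative g ≠ 0 →
      C (c ^ 2) * g * (f ^ 3 + C (A' : ℚ) * f * g ^ 2 + C (B' : ℚ) * g ^ 3) =
        (X ^ 3 + C (A : ℚ) * X + C (B : ℚ)) * (derivative f * g - f * derivative g) ^ 2 →
    ∀ (a b : ℚ), ∀ (r r' : KZ.IntegralRep 1),
      r.domain = {x | 0 < x 0 ^ 3 + (A : ℝ) * x 0 + (B : ℝ)} →
      EqOn r.integrand (fun x => (a : ℝ) / Real.sqrt (x 0 ^ 3 + (A : ℝ) * x 0 + (B : ℝ))) r.domain →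
      r'.domain = {x | 0 < x 0 ^ 3 + (A' : ℝ) * x 0 + (B' : ℝ)} →
      EqOn r'.integrand (fun x => (b : ℝ) / Real.sqrt (x 0 ^ 3 + (A' : ℝ) * x 0 + (B' : ℝ))) r'.domain →
      r.value = r'.value → KZ.Equivalent r r' := by
  refine Iff.intro (fun h A B A' B' hΔ hΔ' f g c hW hI a b r r' h1 h2 h3 h4 h5 => ?_)
    (fun h A B A' B' hΔ hΔ' f g c hW hI a b _ _ r r' h1 h2 h3 h4 h5 =>
      h A B A' B' hΔ hΔ' f g c hW hI a b r r' h1 h2 h3 h4 h5)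
  have H := h A B A' B' hΔ hΔ' f g c hW hI
  have pos_r : 0 < a → 0 < r.value := fun ha => value_pos r h1 h2 ha
  have pos_r' : 0 < b → 0 < r'.value := fun hb => value_pos r' h3 h4 hb
  have neg_r : a < 0 → r.value < 0 := fun ha => by
    have := value_pos (a := -a) r.neg h1 (eqOn_neg_integrand r h2) (by linarith)
    rw [KZ.IntegralRep.value_neg] at this; linarith
  have neg_r' : b < 0 → r'.value < 0 := fun hb => by
    have := value_pos (a := -b) r'.neg h3 (eqOn_neg_integrand r' h4) (by linarith)
    rw [KZ.IntegralRep.value_neg] at this; linarith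
  have zero_r : a = 0 → r.value = 0 := fun ha => by
    rw [value_eq r h1 h2, ha]; simp
  have zero_r' : b = 0 → r'.value = 0 := fun hb => by
    rw [value_eq r' h3 h4, hb]; simp
  rcases lt_trichotomy 0 a with ha | rfl | ha <;> rcases lt_trichotomy 0 b with hb | rfl | hb
  · exact H a b ha hb r r' h1 h2 h3 h4 h5
  · exfalso; linarith [pos_r ha, zero_r' rfl]
  · exfalso; linarith [pos_r ha, neg_r' hb]
  · exfalso; linarith [pos_r' hb, zero_r rfl]
  · -- both scalars vanish: each representation is a relation (`[s] = [s] + [s]` for a zero integrand)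
    have key : ∀ s : KZ.IntegralRep 1, EqOn s.integrand 0 s.domain → KZ.of s ∈ KZ.relations := by
      intro s hs
      have h : KZ.of s - KZ.of s - KZ.of s ∈ KZ.relations :=
        KZ.integrandAddRel_subset_relations ⟨1, s, s, s, rfl, rfl, fun x hx => by simp [hs hx], rfl⟩
      rw [sub_self, zero_sub] at h
      simpa using KZ.relations.neg_mem h
    exact KZ.relations.sub_mem (key r fun x hx => by simp [h2 hx]) (key r' fun x hx => by simp [h4 hx])
  · exfalso; linarith [neg_r' hb, zero_r rfl]
  · exfalso; linarith [neg_r ha, pos_r' hb]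
  · exfalso; linarith [neg_r ha, zero_r' rfl]
  · apply equivalent_of_equivalent_neg
    exact H (-a) (-b) (by linarith) (by linarith) r.neg r'.neg h1 (eqOn_neg_integrand r h2) h3
      (eqOn_neg_integrand r' h4) (by simp [h5])

end Summit.KontsevichZagierPeriods.IsogenyCertificates.XMapPeriodTransferValue
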